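import Literature.IUT.HodgeTheaters.CoveringsErrataCuspidalProofs
import Literature.IUT.HodgeTheaters.CoveringsErrataCuspidalityReductionNegative
import Literature.AnabelianGeometry.SemiGraphs.PSCUnrVerticialOneVertex
import HarnessLib

/-!
# [IUTchI] Remark 1.2.3 (vi) (`Rmk123.GroupTheoreticCuspidalityReduction`, FACT-LIST row F-1978):
# BINDER-FREE instance form at the PROFINITE origin, and its genuine inhabitant (proof-only)

S. Mochizuki, *Inter-universal Teichmüller theory I*, kurims manuscript (May 2020), §1, Remark 1.2.3 (vi) p. 43 —
the replacement text of the second paragraph of the proof of [CombGC] Theorem 1.6 (i): "the fact that `α` is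
group-theoretically cuspidal follows formally from the characterization of cuspidal edge-like subgroups given in
Remark 1.4.3 and the characterization of cuspidally totally ramified cyclic finite étale coverings given in Remark
1.4.2" [cite: Mochizuki2012, IUTchI Rmk 1.2.3 (vi) p.43] (D-0012 claim key; the series' status is DISPUTED; the
content used here is combinatorial anabelian group theory over abc-iut-L3-t4's interface `PSCDatum`, no side
taken).  abc-iut cell, block F, KEY INST59L1 (seat abc-iut-f-186 gen 3), FACT-LIST row **F-1978**.

The row is typed (`CoveringsErrata.lean`, abc-iut-L5-t6) as the SCHEMA `Rmk123.GroupTheoreticCuspidalityReduction Ω`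
over the BLACKBOX origin parameter `Ω : PSCOrigin` ([CombGC] Def. 1.1 (i)).  Kernel status before this file
(plan/LF-KERNEL-STATUS.tsv 2026-08-27T12:11Z): universal closure REFUTED (`not_forall_groupTheoreticCuspidalityReduction`,
abc-iut-f-186 gen 0: junk data over the DISCRETE divisible group `ℚ` at the all-inclusive origin) · conditional
closer `groupTheoreticCuspidalityReduction_of_compactOrigin` (abc-iut-w4-d068, from abc-iut-w4-d052's kernel
`PSCDatum.isGroupTheoreticallyCuspidal_of_isNumericallyCuspidal`) · NO instance-type theorem.  PROOF-ONLY
companion (no `def`, no `instance`, nothing re-typed); this file records: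

* `groupTheoreticCuspidalityReduction_profiniteOrigin` — **INSTANCE FORM, 0 binders, 0 hypotheses**: the row HOLDS
  at the PROFINITE ORIGIN `Ω_cpt` := "every datum over a compact `Π` is declared of PSC-type" (written inline as an
  anonymous `PSCOrigin`, this file declaring no definition).  This origin CONTAINS the intended geometric origin of
  Def. 1.1 (i) (pro-`Σ` completions are profinite), so the instance is at GENUINE data, not a toy: compactness is
  exactly the interface datum whose absence the closure refutation exploits;
* `exists_genuine_mem_profiniteOrigin` — NON-VACUITY: `Ω_cpt` is inhabited by the genuine STURDY datum of a smooth
  genus-2 curve with ONE marked point in characteristic 0 (carrier `Γ̂_{2,1}` = profinite completion of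
  `Γ_{2,1}`, `Σ` = all primes, one vertex of genus 2 with `Π_v = Π`, one cusp; abc-iut-L3-t4 lineage's
  `PSCDatum.not_unrVerticialCharacterizationHolds_of_genus2OnePoint`, BY NAME) — a datum WITH a cusp, so the row's
  cuspidal vocabulary is not idle there;
* `groupTheoreticCuspidalityReduction_profiniteOrigin_decided` — the schema is decided both ways in universe 0
  (holds at `Ω_cpt`, fails at the all-inclusive origin).

HONEST FRAMING: an instance-form theorem about OUR typed statement over OUR interface; typed ≠ proved in print;
refuted-as-typed (closure) ≠ refuted-in-print; nothing here bears on [IUTchIII] Cor. 3.12 or asserts anything about abc.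
-/

namespace Literature.IUT.HodgeTheaters.Rmk123

open Literature.AnabelianGeometry.SemiGraphs
open Literature.GroupTheory.CombinatorialGroupTheory (PuncturedSurfaceGroup)

/-- **[IUTchI] Rmk. 1.2.3 (vi) HOLDS at the profinite origin — instance form of F-1978, no binders, no hypotheses.**
At the origin declaring "of PSC-type" exactly the data over a COMPACT topological group `Π` (every pro-`Σ` completion
of Def. 1.1 (i) is such), numerically cuspidal ⟹ group-theoretically cuspidal at `Σ = {l}`, granted the two amended
characterizations for `G` and `H` displayed in the row — by `groupTheoreticCuspidalityReduction_of_compactOrigin`.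
[cite: Mochizuki2012, IUTchI Rmk 1.2.3 (vi) p.43] -/
theorem groupTheoreticCuspidalityReduction_profiniteOrigin :
    Literature.IUT.HodgeTheaters.Rmk123.GroupTheoreticCuspidalityReduction
      (⟨fun {Q} _ _ _ => CompactSpace Q⟩ : PSCOrigin.{0}) :=
  groupTheoreticCuspidalityReduction_of_compactOrigin _ fun _ _ _ _ h => h

/-- **The profinite origin is inhabited by GENUINE sturdy data with a cusp**: the datum of a smooth genus-2 curve
with one marked point in characteristic 0 (`Π = Γ̂_{2,1}`, `Σ` = all primes, one vertex of genus 2 with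
`Π_v = Π`, no node, one cusp) is declared of PSC-type by `Ω_cpt` (its `Π` is a profinite completion, hence
compact).  So `groupTheoreticCuspidalityReduction_profiniteOrigin` is not an instance at an empty origin.
[cite: Mochizuki2012, IUTchI Rmk 1.2.3 (vi) p.43] -/
theorem exists_genuine_mem_profiniteOrigin :
    ∃ G : PSCDatum (profiniteCompletion (PuncturedSurfaceGroup 2 1)),
      (⟨fun {Q} _ _ _ => CompactSpace Q⟩ : PSCOrigin.{0}).IsOfPSCType G ∧
        G.Sigma = {p | p.Prime} ∧ G.graph.i = 1 ∧ G.graph.n = 0 ∧ G.graph.r = 1 ∧ G.IsSturdy ∧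
        ∀ v, G.vertGp v = ⊤ ∧ G.genus v = 2 := by
  obtain ⟨G, hSig, hi, hn, hr, hst, hv, -, -, -⟩ :=
    PSCDatum.not_unrVerticialCharacterizationHolds_of_genus2OnePoint
  exact ⟨G, (inferInstance : CompactSpace (profiniteCompletion (PuncturedSurfaceGroup 2 1))), hSig, hi, hn,
    hr, hst, hv⟩

/-- **F-1978 decided both ways in universe 0**: the schema HOLDS at the (inhabited, genuine) profinite origin and
FAILS at the all-inclusive origin (`not_forall_groupTheoreticCuspidalityReduction`, abc-iut-f-186 gen 0) — an
origin-relative assumption label whose content is the profinite instance. [cite: Mochizuki2012, IUTchI Rmk 1.2.3 (vi) p.43] -/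
theorem groupTheoreticCuspidalityReduction_profiniteOrigin_decided :
    (∃ Ω : PSCOrigin.{0},
        (∃ G : PSCDatum (profiniteCompletion (PuncturedSurfaceGroup 2 1)), Ω.IsOfPSCType G ∧ G.IsSturdy) ∧
          GroupTheoreticCuspidalityReduction Ω) ∧
      ¬ ∀ Ω : PSCOrigin.{0}, GroupTheoreticCuspidalityReduction Ω := by
  refine ⟨⟨_, ?_, groupTheoreticCuspidalityReduction_profiniteOrigin⟩,
    not_forall_groupTheoreticCuspidalityReduction⟩
  obtain ⟨G, hG, -, -, -, -, hst, -⟩ := exists_genuine_mem_profiniteOrigin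
  exact ⟨G, hG, hst⟩

end Literature.IUT.HodgeTheaters.Rmk123
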